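import Summits.QuantumFields.YangMills.Theorems.SwapVirialDeficitGnomonicJetFourWords
import Summits.QuantumFields.YangMills.Theorems.SwapVirialDeficitGnomonicJetFourLeaders
import Summits.QuantumFields.YangMills.Theorems.SwapVirialDeficitGnomonicJetDeficit
import HarnessLib

/-!
# W4 (order-4 jets), part K5: `|d⁴/dt⁴ qDeficit| ≤ 609984·L⁴·M⁴` along a history whose links carry 4-jets of size `M`, and the gnomonic blow-up
# (free-hands support of ⟨stmt-QuantumFields-24197⟩ `SwapVirialDeficit.SwapGluedStiffness`)

Order-four twin of ✓`…GnomonicJetDeficit` (J3b), for LEAD g97's brick W4 (steep-window Morse–Bott §1 (B-bulk)), on K1–K4: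
* §1 words: `jet4_letter`, `jet4_ringConfig_fst` (`a + b`), `jet4_glue_ringConfig`, `jet4_ringConfig_snd_fst` (`a + b + b`), `jet4_ringConfig_snd_snd`,
  ★★ `jet4_fixHistory` — every link ∕ site quaternion of `fixHistory (ringConfig χ (C t, U t))` carries a 4-jet of size `a + b + b`;
* §2 ★★★ `realJet4_qDeficit_le` — links ∕ sites with 4-jets of size `M ≥ 0` ⟹ `t ↦ qDeficit z (Q t)` has four derivatives everywhere with
  `|d/dt| ≤ 144·L⁴·M`, `|d²| ≤ 816·L⁴·M²`, `|d³| ≤ 19872·L⁴·M³`, `|d⁴/dt⁴| ≤ 609984·L⁴·M⁴`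
  (fourth order per slice: coupling `864`, Wilson half-sum `13824`, seam coupling `13824`, seam Wilson half-sum `566784`, all `·L³M⁴`);
* §3 ★★★ `realJet4_chartDeficit_gnomonic_le` — along `t ↦ chartDeficit L z χ (blowUpPoint t (gnomonicPoint a ε η))`, hub `a ≠ 0`, all letter sizes `≤ A`
  (leaders `≤ 3A`, followers `≤ A`, links `≤ 5A`): `|d/dt| ≤ 720·L⁴·A`, `|d²| ≤ 20400·L⁴·A²`, `|d³| ≤ 2484000·L⁴·A³`, `|d⁴/dt⁴| ≤ 381240000·L⁴·A⁴`
  — polynomial in `L` (free on a steep window, LEAD memo (R1)) and QUARTIC in the letter size.  Part K6 packages the order-4 Taylor datum.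

HONEST LABEL: calculus bookkeeping with explicit polynomial constants; no estimate on the ring's Gibbs state; nothing about ⟨24197⟩ (window-uniform, OPEN), (LW),
(M), W3–W9 or any rung is proved; ⟨24194⟩ ∕ ⟨24196⟩ ∕ ⟨24497⟩ OPEN; item of record ⟨24085⟩ SubOctaveBounded aside ∕ untouched; the Yang–Mills mass gap is NOT
proved; no summit is proved by a line.  THEOREMS ONLY (0 `def`, 0 `sorry`), standard axioms, no local instances.  Seat ym-line-fcl-p3 g47 (cell ym-idea-1, free
hands), `--supports stmt-QuantumFields-24197`.  References: [cite: Luscher1983, §2]; [folklore].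
-/

set_option autoImplicit false

noncomputable section

open Quaternion
open scoped Quaternion BigOperators
open Literature.MathematicalPhysics.QuantumLattice
open Literature.MathematicalPhysics.QuantumFieldTheory hiding SU2
open Summit.QuantumFields.YangMills.Theorems.FemtoTransferGap
open Summit.QuantumFields.YangMills.Theorems.FemtoTransferGap.TT
open Summit.QuantumFields.YangMills.Theorems.SwapVirialDeficit.BlowUp (leaderTuple qTimeCoupling qPlaq qWilson qGauge qTwist3 qSwap qSeam qDeficit
  swapRingDeficit_eq_qDeficit)
open Summit.QuantumFields.YangMills.Theorems.SwapVirialDeficit.BlowUpRing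

namespace Summit.QuantumFields.YangMills.Theorems.SwapVirialDeficit.Gnomonic

variable {L : ℕ} [NeZero L]

/-! ## §1 Words: every link ∕ site quaternion of the rebuilt ring carries a 4-jet of size `a + b + b` -/

section Words

variable {C : ℝ → Fin 4 → SU2} {U : ℝ → Fol L → SU2} {a b : ℝ}

omit [NeZero L] in
/-- The letter of a slice-`0` link (`C_ν` or `1`) carries a 4-jet of size `a`. [folklore] -/
theorem jet4_letter (ha : 0 ≤ a)
    (hC : ∀ μ, ∃ f₁ f₂ f₃ f₄ : ℝ → ℍ, (∀ t, HasDerivAt (fun t => su2Quat (C t μ)) (f₁ t) t) ∧ (∀ t, HasDerivAt f₁ (f₂ t) t) ∧ (∀ t, HasDerivAt f₂ (f₃ t) t) ∧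
      (∀ t, HasDerivAt f₃ (f₄ t) t) ∧ ∀ t, ‖su2Quat (C t μ)‖ ≤ 1 ∧ ‖f₁ t‖ ≤ a ∧ ‖f₂ t‖ ≤ a ^ 2 ∧ ‖f₃ t‖ ≤ 3 * a ^ 3 ∧ ‖f₄ t‖ ≤ 9 * a ^ 4) (i : OffIdx L) :
    ∃ f₁ f₂ f₃ f₄ : ℝ → ℍ, (∀ t, HasDerivAt (fun t => su2Quat (letter (fun μ => C t (Fin.castSucc μ)) i)) (f₁ t) t) ∧ (∀ t, HasDerivAt f₁ (f₂ t) t) ∧ (∀ t, HasDerivAt f₂ (f₃ t) t) ∧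
      (∀ t, HasDerivAt f₃ (f₄ t) t) ∧ ∀ t, ‖su2Quat (letter (fun μ => C t (Fin.castSucc μ)) i)‖ ≤ 1 ∧ ‖f₁ t‖ ≤ a ∧ ‖f₂ t‖ ≤ a ^ 2 ∧ ‖f₃ t‖ ≤ 3 * a ^ 3 ∧ ‖f₄ t‖ ≤ 9 * a ^ 4 := by
  by_cases h : i.1.1 i.1.2 = -1
  · simp only [letter, h, if_true]; exact hC _
  · simp only [letter, h, if_false, su2Quat_one]; exact jet4_const 1 (by simp) ha

/-- ★ A slice-`0` link carries a 4-jet of size `a + b`. [folklore] -/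
theorem jet4_ringConfig_fst (χ : Site 3 L → SU2) (ha : 0 ≤ a) (hb : 0 ≤ b)
    (hC : ∀ μ, ∃ f₁ f₂ f₃ f₄ : ℝ → ℍ, (∀ t, HasDerivAt (fun t => su2Quat (C t μ)) (f₁ t) t) ∧ (∀ t, HasDerivAt f₁ (f₂ t) t) ∧ (∀ t, HasDerivAt f₂ (f₃ t) t) ∧
      (∀ t, HasDerivAt f₃ (f₄ t) t) ∧ ∀ t, ‖su2Quat (C t μ)‖ ≤ 1 ∧ ‖f₁ t‖ ≤ a ∧ ‖f₂ t‖ ≤ a ^ 2 ∧ ‖f₃ t‖ ≤ 3 * a ^ 3 ∧ ‖f₄ t‖ ≤ 9 * a ^ 4)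
    (hU : ∀ i, ∃ f₁ f₂ f₃ f₄ : ℝ → ℍ, (∀ t, HasDerivAt (fun t => su2Quat (U t i)) (f₁ t) t) ∧ (∀ t, HasDerivAt f₁ (f₂ t) t) ∧ (∀ t, HasDerivAt f₂ (f₃ t) t) ∧
      (∀ t, HasDerivAt f₃ (f₄ t) t) ∧ ∀ t, ‖su2Quat (U t i)‖ ≤ 1 ∧ ‖f₁ t‖ ≤ b ∧ ‖f₂ t‖ ≤ b ^ 2 ∧ ‖f₃ t‖ ≤ 3 * b ^ 3 ∧ ‖f₄ t‖ ≤ 9 * b ^ 4) (i : OffIdx L) :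
    ∃ f₁ f₂ f₃ f₄ : ℝ → ℍ, (∀ t, HasDerivAt (fun t => su2Quat ((ringConfig χ (C t, U t)).1 i)) (f₁ t) t) ∧ (∀ t, HasDerivAt f₁ (f₂ t) t) ∧ (∀ t, HasDerivAt f₂ (f₃ t) t) ∧
      (∀ t, HasDerivAt f₃ (f₄ t) t) ∧ ∀ t, ‖su2Quat ((ringConfig χ (C t, U t)).1 i)‖ ≤ 1 ∧ ‖f₁ t‖ ≤ (a + b) ∧ ‖f₂ t‖ ≤ (a + b) ^ 2 ∧ ‖f₃ t‖ ≤ 3 * (a + b) ^ 3 ∧ ‖f₄ t‖ ≤ 9 * (a + b) ^ 4 := by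
  by_cases h : isLead i = true
  · simp only [ringConfig_fst_of_isLead χ _ h]
    exact jet4_mono ha (le_add_of_nonneg_right hb) (hC (Fin.castSucc i.1.2))
  · have e : ∀ t, su2Quat ((ringConfig χ (C t, U t)).1 i) = su2Quat (letter (fun μ => C t (Fin.castSucc μ)) i) * su2Quat (U t (Sum.inl ⟨i, h⟩)) := by
      intro t; rw [← su2Quat_mul]; exact congrArg su2Quat (ringConfig_fst_of_not_isLead χ (C t, U t) ⟨i, h⟩)
    simp only [e]
    exact jet4_mul ha hb (jet4_letter ha hC i) (hU (Sum.inl ⟨i, h⟩))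

/-- ★ A glued slice-`0` link carries a 4-jet of size `a + b`. [folklore] -/
theorem jet4_glue_ringConfig (χ : Site 3 L → SU2) (ha : 0 ≤ a) (hb : 0 ≤ b)
    (hC : ∀ μ, ∃ f₁ f₂ f₃ f₄ : ℝ → ℍ, (∀ t, HasDerivAt (fun t => su2Quat (C t μ)) (f₁ t) t) ∧ (∀ t, HasDerivAt f₁ (f₂ t) t) ∧ (∀ t, HasDerivAt f₂ (f₃ t) t) ∧
      (∀ t, HasDerivAt f₃ (f₄ t) t) ∧ ∀ t, ‖su2Quat (C t μ)‖ ≤ 1 ∧ ‖f₁ t‖ ≤ a ∧ ‖f₂ t‖ ≤ a ^ 2 ∧ ‖f₃ t‖ ≤ 3 * a ^ 3 ∧ ‖f₄ t‖ ≤ 9 * a ^ 4)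
    (hU : ∀ i, ∃ f₁ f₂ f₃ f₄ : ℝ → ℍ, (∀ t, HasDerivAt (fun t => su2Quat (U t i)) (f₁ t) t) ∧ (∀ t, HasDerivAt f₁ (f₂ t) t) ∧ (∀ t, HasDerivAt f₂ (f₃ t) t) ∧
      (∀ t, HasDerivAt f₃ (f₄ t) t) ∧ ∀ t, ‖su2Quat (U t i)‖ ≤ 1 ∧ ‖f₁ t‖ ≤ b ∧ ‖f₂ t‖ ≤ b ^ 2 ∧ ‖f₃ t‖ ≤ 3 * b ^ 3 ∧ ‖f₄ t‖ ≤ 9 * b ^ 4) (e : Edge 3 L) :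
    ∃ f₁ f₂ f₃ f₄ : ℝ → ℍ, (∀ t, HasDerivAt (fun t => su2Quat (glue (ringConfig χ (C t, U t)).1 e)) (f₁ t) t) ∧ (∀ t, HasDerivAt f₁ (f₂ t) t) ∧ (∀ t, HasDerivAt f₂ (f₃ t) t) ∧
      (∀ t, HasDerivAt f₃ (f₄ t) t) ∧ ∀ t, ‖su2Quat (glue (ringConfig χ (C t, U t)).1 e)‖ ≤ 1 ∧ ‖f₁ t‖ ≤ (a + b) ∧ ‖f₂ t‖ ≤ (a + b) ^ 2 ∧ ‖f₃ t‖ ≤ 3 * (a + b) ^ 3 ∧ ‖f₄ t‖ ≤ 9 * (a + b) ^ 4 := by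
  by_cases h : treeEdge e = true
  · simp only [su2Quat_glue, h, dif_pos]; exact jet4_const 1 (by simp) (add_nonneg ha hb)
  · simp only [su2Quat_glue, h]
    exact jet4_ringConfig_fst χ ha hb hC hU ⟨e, h⟩

/-- ★ A slice-`j` link (`j ≥ 1`) carries a 4-jet of size `a + b + b`. [folklore] -/
theorem jet4_ringConfig_snd_fst (χ : Site 3 L → SU2) (ha : 0 ≤ a) (hb : 0 ≤ b)
    (hC : ∀ μ, ∃ f₁ f₂ f₃ f₄ : ℝ → ℍ, (∀ t, HasDerivAt (fun t => su2Quat (C t μ)) (f₁ t) t) ∧ (∀ t, HasDerivAt f₁ (f₂ t) t) ∧ (∀ t, HasDerivAt f₂ (f₃ t) t) ∧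
      (∀ t, HasDerivAt f₃ (f₄ t) t) ∧ ∀ t, ‖su2Quat (C t μ)‖ ≤ 1 ∧ ‖f₁ t‖ ≤ a ∧ ‖f₂ t‖ ≤ a ^ 2 ∧ ‖f₃ t‖ ≤ 3 * a ^ 3 ∧ ‖f₄ t‖ ≤ 9 * a ^ 4)
    (hU : ∀ i, ∃ f₁ f₂ f₃ f₄ : ℝ → ℍ, (∀ t, HasDerivAt (fun t => su2Quat (U t i)) (f₁ t) t) ∧ (∀ t, HasDerivAt f₁ (f₂ t) t) ∧ (∀ t, HasDerivAt f₂ (f₃ t) t) ∧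
      (∀ t, HasDerivAt f₃ (f₄ t) t) ∧ ∀ t, ‖su2Quat (U t i)‖ ≤ 1 ∧ ‖f₁ t‖ ≤ b ∧ ‖f₂ t‖ ≤ b ^ 2 ∧ ‖f₃ t‖ ≤ 3 * b ^ 3 ∧ ‖f₄ t‖ ≤ 9 * b ^ 4) (j : Fin (2 * L - 1)) (e : Edge 3 L) :
    ∃ f₁ f₂ f₃ f₄ : ℝ → ℍ, (∀ t, HasDerivAt (fun t => su2Quat ((ringConfig χ (C t, U t)).2.1 j e)) (f₁ t) t) ∧ (∀ t, HasDerivAt f₁ (f₂ t) t) ∧ (∀ t, HasDerivAt f₂ (f₃ t) t) ∧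
      (∀ t, HasDerivAt f₃ (f₄ t) t) ∧ ∀ t, ‖su2Quat ((ringConfig χ (C t, U t)).2.1 j e)‖ ≤ 1 ∧ ‖f₁ t‖ ≤ (a + b + b) ∧ ‖f₂ t‖ ≤ (a + b + b) ^ 2 ∧ ‖f₃ t‖ ≤ 3 * (a + b + b) ^ 3 ∧ ‖f₄ t‖ ≤ 9 * (a + b + b) ^ 4 := by
  have e' : ∀ t, su2Quat ((ringConfig χ (C t, U t)).2.1 j e) = su2Quat (glue (ringConfig χ (C t, U t)).1 e) * su2Quat (U t (Sum.inr (Sum.inl (j, e)))) := by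
    intro t; rw [ringConfig_snd_fst, su2Quat_mul]
  simp only [e']
  exact jet4_mul (add_nonneg ha hb) hb (jet4_glue_ringConfig χ ha hb hC hU e) (hU (Sum.inr (Sum.inl (j, e))))

/-- ★ A seam-site quaternion carries a 4-jet of size `a + b + b`. [folklore] -/
theorem jet4_ringConfig_snd_snd (χ : Site 3 L → SU2) (ha : 0 ≤ a) (hb : 0 ≤ b)
    (hC : ∀ μ, ∃ f₁ f₂ f₃ f₄ : ℝ → ℍ, (∀ t, HasDerivAt (fun t => su2Quat (C t μ)) (f₁ t) t) ∧ (∀ t, HasDerivAt f₁ (f₂ t) t) ∧ (∀ t, HasDerivAt f₂ (f₃ t) t) ∧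
      (∀ t, HasDerivAt f₃ (f₄ t) t) ∧ ∀ t, ‖su2Quat (C t μ)‖ ≤ 1 ∧ ‖f₁ t‖ ≤ a ∧ ‖f₂ t‖ ≤ a ^ 2 ∧ ‖f₃ t‖ ≤ 3 * a ^ 3 ∧ ‖f₄ t‖ ≤ 9 * a ^ 4)
    (hU : ∀ i, ∃ f₁ f₂ f₃ f₄ : ℝ → ℍ, (∀ t, HasDerivAt (fun t => su2Quat (U t i)) (f₁ t) t) ∧ (∀ t, HasDerivAt f₁ (f₂ t) t) ∧ (∀ t, HasDerivAt f₂ (f₃ t) t) ∧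
      (∀ t, HasDerivAt f₃ (f₄ t) t) ∧ ∀ t, ‖su2Quat (U t i)‖ ≤ 1 ∧ ‖f₁ t‖ ≤ b ∧ ‖f₂ t‖ ≤ b ^ 2 ∧ ‖f₃ t‖ ≤ 3 * b ^ 3 ∧ ‖f₄ t‖ ≤ 9 * b ^ 4) (x : Site 3 L) :
    ∃ f₁ f₂ f₃ f₄ : ℝ → ℍ, (∀ t, HasDerivAt (fun t => su2Quat ((ringConfig χ (C t, U t)).2.2 x)) (f₁ t) t) ∧ (∀ t, HasDerivAt f₁ (f₂ t) t) ∧ (∀ t, HasDerivAt f₂ (f₃ t) t) ∧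
      (∀ t, HasDerivAt f₃ (f₄ t) t) ∧ ∀ t, ‖su2Quat ((ringConfig χ (C t, U t)).2.2 x)‖ ≤ 1 ∧ ‖f₁ t‖ ≤ (a + b + b) ∧ ‖f₂ t‖ ≤ (a + b + b) ^ 2 ∧ ‖f₃ t‖ ≤ 3 * (a + b + b) ^ 3 ∧ ‖f₄ t‖ ≤ 9 * (a + b + b) ^ 4 := by
  by_cases h : x = 0
  · subst h
    simp only [ringConfig_snd_snd_zero]
    exact jet4_mono ha (by linarith) (hC (Fin.last 3))
  · have e : ∀ t, su2Quat ((ringConfig χ (C t, U t)).2.2 x) = su2Quat (χ x) * su2Quat (C t (Fin.last 3)) * su2Quat (U t (Sum.inr (Sum.inr ⟨x, h⟩))) := by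
      intro t; rw [← su2Quat_mul, ← su2Quat_mul]; exact congrArg su2Quat (ringConfig_snd_snd_of_ne χ (C t, U t) ⟨x, h⟩)
    simp only [e]
    have h1 := jet4_mul le_rfl ha (jet4_const (su2Quat (χ x)) (norm_su2Quat _).le le_rfl) (hC (Fin.last 3))
    have h2 := jet4_mul (by positivity) hb h1 (hU (Sum.inr (Sum.inr ⟨x, h⟩)))
    exact jet4_mono (by positivity) (by linarith) h2

/-- ★★ **EVERY LINK ∕ SITE QUATERNION OF THE REBUILT RING CARRIES A 4-JET OF SIZE `a + b + b`** when the leader letters carry size `a` and the follower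
letters size `b` (words of at most three letters, ✓`fixHistory`). [folklore] -/
theorem jet4_fixHistory (χ : Site 3 L → SU2) (ha : 0 ≤ a) (hb : 0 ≤ b)
    (hC : ∀ μ, ∃ f₁ f₂ f₃ f₄ : ℝ → ℍ, (∀ t, HasDerivAt (fun t => su2Quat (C t μ)) (f₁ t) t) ∧ (∀ t, HasDerivAt f₁ (f₂ t) t) ∧ (∀ t, HasDerivAt f₂ (f₃ t) t) ∧
      (∀ t, HasDerivAt f₃ (f₄ t) t) ∧ ∀ t, ‖su2Quat (C t μ)‖ ≤ 1 ∧ ‖f₁ t‖ ≤ a ∧ ‖f₂ t‖ ≤ a ^ 2 ∧ ‖f₃ t‖ ≤ 3 * a ^ 3 ∧ ‖f₄ t‖ ≤ 9 * a ^ 4)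
    (hU : ∀ i, ∃ f₁ f₂ f₃ f₄ : ℝ → ℍ, (∀ t, HasDerivAt (fun t => su2Quat (U t i)) (f₁ t) t) ∧ (∀ t, HasDerivAt f₁ (f₂ t) t) ∧ (∀ t, HasDerivAt f₂ (f₃ t) t) ∧
      (∀ t, HasDerivAt f₃ (f₄ t) t) ∧ ∀ t, ‖su2Quat (U t i)‖ ≤ 1 ∧ ‖f₁ t‖ ≤ b ∧ ‖f₂ t‖ ≤ b ^ 2 ∧ ‖f₃ t‖ ≤ 3 * b ^ 3 ∧ ‖f₄ t‖ ≤ 9 * b ^ 4) :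
    (∀ (i : Fin (2 * L - 1 + 1)) (e : Edge 3 L), ∃ f₁ f₂ f₃ f₄ : ℝ → ℍ, (∀ t, HasDerivAt (fun t => su2Quat ((fixHistory (ringConfig χ (C t, U t))).1 i e)) (f₁ t) t) ∧ (∀ t, HasDerivAt f₁ (f₂ t) t) ∧ (∀ t, HasDerivAt f₂ (f₃ t) t) ∧
      (∀ t, HasDerivAt f₃ (f₄ t) t) ∧ ∀ t, ‖su2Quat ((fixHistory (ringConfig χ (C t, U t))).1 i e)‖ ≤ 1 ∧ ‖f₁ t‖ ≤ (a + b + b) ∧ ‖f₂ t‖ ≤ (a + b + b) ^ 2 ∧ ‖f₃ t‖ ≤ 3 * (a + b + b) ^ 3 ∧ ‖f₄ t‖ ≤ 9 * (a + b + b) ^ 4) ∧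
      ∀ x : Site 3 L, ∃ f₁ f₂ f₃ f₄ : ℝ → ℍ, (∀ t, HasDerivAt (fun t => su2Quat ((fixHistory (ringConfig χ (C t, U t))).2 x)) (f₁ t) t) ∧ (∀ t, HasDerivAt f₁ (f₂ t) t) ∧ (∀ t, HasDerivAt f₂ (f₃ t) t) ∧
      (∀ t, HasDerivAt f₃ (f₄ t) t) ∧ ∀ t, ‖su2Quat ((fixHistory (ringConfig χ (C t, U t))).2 x)‖ ≤ 1 ∧ ‖f₁ t‖ ≤ (a + b + b) ∧ ‖f₂ t‖ ≤ (a + b + b) ^ 2 ∧ ‖f₃ t‖ ≤ 3 * (a + b + b) ^ 3 ∧ ‖f₄ t‖ ≤ 9 * (a + b + b) ^ 4 := by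
  refine ⟨fun i e => ?_, fun x => jet4_ringConfig_snd_snd χ ha hb hC hU x⟩
  refine Fin.cases ?_ (fun j => ?_) i
  · simp only [fixHistory, Fin.cons_zero]
    exact jet4_mono (add_nonneg ha hb) (by linarith) (jet4_glue_ringConfig χ ha hb hC hU e)
  · simp only [fixHistory, Fin.cons_succ]
    exact jet4_ringConfig_snd_fst χ ha hb hC hU j e

end Words

/-! ## §2 The σ-glued deficit along a history whose links carry 4-jets -/

/-- ★★★ **THE FOURTH DERIVATIVE OF THE σ-GLUED DEFICIT ALONG A MOVING QUATERNION HISTORY**: if every link quaternion `(Q t).1 i e` and every seam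
quaternion `(Q t).2 x` carries a 4-jet of size `M ≥ 0`, then `t ↦ qDeficit z (Q t)` has four derivatives everywhere with `|d/dt| ≤ 144·L⁴·M`,
`|d²/dt²| ≤ 816·L⁴·M²`, `|d³/dt³| ≤ 19872·L⁴·M³`, `|d⁴/dt⁴| ≤ 609984·L⁴·M⁴`. [cite: Luscher1983, §2] -/
theorem realJet4_qDeficit_le (z : Fin 3 → Bool) {Q : ℝ → (Fin (2 * L - 1 + 1) → Edge 3 L → ℍ) × (Site 3 L → ℍ)} {M : ℝ} (hM : 0 ≤ M)
    (h1 : ∀ i e, ∃ f₁ f₂ f₃ f₄ : ℝ → ℍ, (∀ t, HasDerivAt (fun t => (Q t).1 i e) (f₁ t) t) ∧ (∀ t, HasDerivAt f₁ (f₂ t) t) ∧ (∀ t, HasDerivAt f₂ (f₃ t) t) ∧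
      (∀ t, HasDerivAt f₃ (f₄ t) t) ∧ ∀ t, ‖(Q t).1 i e‖ ≤ 1 ∧ ‖f₁ t‖ ≤ M ∧ ‖f₂ t‖ ≤ M ^ 2 ∧ ‖f₃ t‖ ≤ 3 * M ^ 3 ∧ ‖f₄ t‖ ≤ 9 * M ^ 4)
    (h2 : ∀ x, ∃ f₁ f₂ f₃ f₄ : ℝ → ℍ, (∀ t, HasDerivAt (fun t => (Q t).2 x) (f₁ t) t) ∧ (∀ t, HasDerivAt f₁ (f₂ t) t) ∧ (∀ t, HasDerivAt f₂ (f₃ t) t) ∧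
      (∀ t, HasDerivAt f₃ (f₄ t) t) ∧ ∀ t, ‖(Q t).2 x‖ ≤ 1 ∧ ‖f₁ t‖ ≤ M ∧ ‖f₂ t‖ ≤ M ^ 2 ∧ ‖f₃ t‖ ≤ 3 * M ^ 3 ∧ ‖f₄ t‖ ≤ 9 * M ^ 4) :
    ∃ d₁ d₂ d₃ d₄ : ℝ → ℝ, (∀ t, HasDerivAt (fun t => qDeficit z (Q t)) (d₁ t) t) ∧ (∀ t, HasDerivAt d₁ (d₂ t) t) ∧ (∀ t, HasDerivAt d₂ (d₃ t) t) ∧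
      (∀ t, HasDerivAt d₃ (d₄ t) t) ∧
      ∀ t, |d₁ t| ≤ 144 * (L : ℝ) ^ 4 * M ∧ |d₂ t| ≤ 816 * (L : ℝ) ^ 4 * M ^ 2 ∧ |d₃ t| ≤ 19872 * (L : ℝ) ^ 4 * M ^ 3 ∧
        |d₄ t| ≤ 609984 * (L : ℝ) ^ 4 * M ^ 4 := by
  have hL1 : (1 : ℝ) ≤ L := by exact_mod_cast NeZero.one_le
  have hE : (Fintype.card (Edge 3 L) : ℝ) = 3 * (L : ℝ) ^ 3 := by rw [FemtoTransferGap.card_edge_three]; push_cast; ring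
  have hP : (Fintype.card (Plaquette 3 L) : ℝ) = 3 * (L : ℝ) ^ 3 := by rw [FemtoTransferGap.card_plaquette_three]; push_cast; ring
  have hL3 : 0 ≤ (L : ℝ) ^ 3 := by positivity
  have hM2 : 0 ≤ M ^ 2 := by positivity
  have hM3 : 0 ≤ M ^ 3 := by positivity
  have hM4 : 0 ≤ M ^ 4 := by positivity
  have h3M : 0 ≤ M + M + M := by positivity
  have hS := fun e => jet4_qSeam z hM h1 h2 e
  -- the four blocks
  have hTC : ∀ i : Fin (2 * L - 1), ∃ d₁ d₂ d₃ d₄ : ℝ → ℝ,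
      (∀ t, HasDerivAt (fun t => 6 * (L : ℝ) ^ 3 - qTimeCoupling ((Q t).1 i.castSucc) ((Q t).1 i.succ)) (d₁ t) t) ∧ (∀ t, HasDerivAt d₁ (d₂ t) t) ∧
      (∀ t, HasDerivAt d₂ (d₃ t) t) ∧ (∀ t, HasDerivAt d₃ (d₄ t) t) ∧
      ∀ t, |d₁ t| ≤ 12 * (L : ℝ) ^ 3 * M ∧ |d₂ t| ≤ 24 * (L : ℝ) ^ 3 * M ^ 2 ∧ |d₃ t| ≤ 144 * (L : ℝ) ^ 3 * M ^ 3 ∧ |d₄ t| ≤ 864 * (L : ℝ) ^ 3 * M ^ 4 := by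
    intro i
    have h := realJet4_const_sub (6 * (L : ℝ) ^ 3) (realJet4_qTimeCoupling hM hM (fun e => h1 i.castSucc e) (fun e => h1 i.succ e))
    rw [hE] at h
    exact realJet4_mono (by nlinarith) (by nlinarith) (by nlinarith) (by nlinarith) h
  have hTCs : ∃ d₁ d₂ d₃ d₄ : ℝ → ℝ,
      (∀ t, HasDerivAt (fun t => 6 * (L : ℝ) ^ 3 - qTimeCoupling ((Q t).1 (Fin.last (2 * L - 1))) (qSeam z (Q t))) (d₁ t) t) ∧
      (∀ t, HasDerivAt d₁ (d₂ t) t) ∧ (∀ t, HasDerivAt d₂ (d₃ t) t) ∧ (∀ t, HasDerivAt d₃ (d₄ t) t) ∧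
      ∀ t, |d₁ t| ≤ 24 * (L : ℝ) ^ 3 * M ∧ |d₂ t| ≤ 96 * (L : ℝ) ^ 3 * M ^ 2 ∧ |d₃ t| ≤ 1152 * (L : ℝ) ^ 3 * M ^ 3 ∧
        |d₄ t| ≤ 13824 * (L : ℝ) ^ 3 * M ^ 4 := by
    have h := realJet4_const_sub (6 * (L : ℝ) ^ 3) (realJet4_qTimeCoupling (U := fun t => (Q t).1 (Fin.last (2 * L - 1)))
      (V := fun t => qSeam z (Q t)) hM h3M (fun e => h1 (Fin.last (2 * L - 1)) e) hS)
    rw [hE] at h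
    exact realJet4_mono (by nlinarith) (by nlinarith) (by nlinarith) (by nlinarith) h
  have hW : ∀ i : Fin (2 * L - 1), ∃ d₁ d₂ d₃ d₄ : ℝ → ℝ,
      (∀ t, HasDerivAt (fun t => (1 / 2 : ℝ) * (qWilson ((Q t).1 i.castSucc) + qWilson ((Q t).1 i.succ))) (d₁ t) t) ∧ (∀ t, HasDerivAt d₁ (d₂ t) t) ∧
      (∀ t, HasDerivAt d₂ (d₃ t) t) ∧ (∀ t, HasDerivAt d₃ (d₄ t) t) ∧
      ∀ t, |d₁ t| ≤ 24 * (L : ℝ) ^ 3 * M ∧ |d₂ t| ≤ 96 * (L : ℝ) ^ 3 * M ^ 2 ∧ |d₃ t| ≤ 1152 * (L : ℝ) ^ 3 * M ^ 3 ∧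
        |d₄ t| ≤ 13824 * (L : ℝ) ^ 3 * M ^ 4 := by
    intro i
    have h := realJet4_const_mul (1 / 2 : ℝ) (realJet4_add (realJet4_qWilson hM (fun e => h1 i.castSucc e)) (realJet4_qWilson hM (fun e => h1 i.succ e)))
    rw [hP, abs_of_pos (by norm_num : (0 : ℝ) < 1 / 2)] at h
    exact realJet4_mono (by nlinarith) (by nlinarith) (by nlinarith) (by nlinarith) h
  have hWs : ∃ d₁ d₂ d₃ d₄ : ℝ → ℝ,
      (∀ t, HasDerivAt (fun t => (1 / 2 : ℝ) * (qWilson ((Q t).1 (Fin.last (2 * L - 1))) + qWilson (qSeam z (Q t)))) (d₁ t) t) ∧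
      (∀ t, HasDerivAt d₁ (d₂ t) t) ∧ (∀ t, HasDerivAt d₂ (d₃ t) t) ∧ (∀ t, HasDerivAt d₃ (d₄ t) t) ∧
      ∀ t, |d₁ t| ≤ 48 * (L : ℝ) ^ 3 * M ∧ |d₂ t| ≤ 480 * (L : ℝ) ^ 3 * M ^ 2 ∧ |d₃ t| ≤ 16128 * (L : ℝ) ^ 3 * M ^ 3 ∧
        |d₄ t| ≤ 566784 * (L : ℝ) ^ 3 * M ^ 4 := by
    have h := realJet4_const_mul (1 / 2 : ℝ) (realJet4_add (realJet4_qWilson hM (fun e => h1 (Fin.last (2 * L - 1)) e))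
      (realJet4_qWilson (U := fun t => qSeam z (Q t)) h3M hS))
    rw [hP, abs_of_pos (by norm_num : (0 : ℝ) < 1 / 2)] at h
    exact realJet4_mono (by nlinarith) (by nlinarith) (by nlinarith) (by nlinarith) h
  -- summing the slices
  have hn : ((Fintype.card (Fin (2 * L - 1)) : ℝ)) ≤ 2 * (L : ℝ) := by
    rw [Fintype.card_fin]
    have : ((2 * L - 1 : ℕ) : ℝ) ≤ ((2 * L : ℕ) : ℝ) := Nat.cast_le.mpr (Nat.sub_le _ _)
    simpa using this
  have hn0 : (0 : ℝ) ≤ (Fintype.card (Fin (2 * L - 1)) : ℝ) := Nat.cast_nonneg _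
  have hA := realJet4_sum hTC
  have hC := realJet4_sum hW
  simp only [Finset.sum_const, Finset.card_univ, nsmul_eq_mul] at hA hC
  have h := realJet4_add (realJet4_add (realJet4_add hA hTCs) hC) hWs
  have h34 : (L : ℝ) ^ 3 ≤ (L : ℝ) ^ 4 := pow_le_pow_right₀ hL1 (by norm_num)
  refine realJet4_mono ?_ ?_ ?_ ?_ (by simpa only [qDeficit] using h)
  · nlinarith [mul_le_mul_of_nonneg_right hn (by positivity : (0 : ℝ) ≤ 12 * (L : ℝ) ^ 3 * M),
      mul_le_mul_of_nonneg_right hn (by positivity : (0 : ℝ) ≤ 24 * (L : ℝ) ^ 3 * M), mul_le_mul_of_nonneg_right h34 hM]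
  · nlinarith [mul_le_mul_of_nonneg_right hn (by positivity : (0 : ℝ) ≤ 24 * (L : ℝ) ^ 3 * M ^ 2),
      mul_le_mul_of_nonneg_right hn (by positivity : (0 : ℝ) ≤ 96 * (L : ℝ) ^ 3 * M ^ 2), mul_le_mul_of_nonneg_right h34 hM2]
  · nlinarith [mul_le_mul_of_nonneg_right hn (by positivity : (0 : ℝ) ≤ 144 * (L : ℝ) ^ 3 * M ^ 3),
      mul_le_mul_of_nonneg_right hn (by positivity : (0 : ℝ) ≤ 1152 * (L : ℝ) ^ 3 * M ^ 3), mul_le_mul_of_nonneg_right h34 hM3]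
  · nlinarith [mul_le_mul_of_nonneg_right hn (by positivity : (0 : ℝ) ≤ 864 * (L : ℝ) ^ 3 * M ^ 4),
      mul_le_mul_of_nonneg_right hn (by positivity : (0 : ℝ) ≤ 13824 * (L : ℝ) ^ 3 * M ^ 4), mul_le_mul_of_nonneg_right h34 hM4]

/-! ## §3 Along the gnomonic blow-up: quartic in the letter size -/

/-- ★★★ **FOURTH-ORDER S-B ALONG THE GNOMONIC BLOW-UP**: for hub `a ≠ 0`, signs `ε`, coordinates `η` with all letter sizes `≤ A`, the deficit
`t ↦ chartDeficit L z χ (blowUpPoint t (gnomonicPoint a ε η))` in the LINEAR blow-up parameter has four derivatives everywhere with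
`|d/dt| ≤ 720·L⁴·A`, `|d²/dt²| ≤ 20400·L⁴·A²`, `|d³/dt³| ≤ 2484000·L⁴·A³`, `|d⁴/dt⁴| ≤ 381240000·L⁴·A⁴` (links `≤ 5A`). [cite: Luscher1983, §2] -/
theorem realJet4_chartDeficit_gnomonic_le (z : Fin 3 → Bool) (χ : Site 3 L → SU2) {a : ℍ} (ha : a ≠ 0) (ε : GnoSign L) (η : GnoCoord L) {A : ℝ}
    (hA : 0 ≤ A) (hx : Real.sqrt ((η.1.1 1 ^ 2 + η.1.1 2 ^ 2) / (1 + η.1.1 0 ^ 2)) ≤ A) (hy : Real.sqrt ((η.1.2 1 ^ 2 + η.1.2 2 ^ 2) / (1 + η.1.2 0 ^ 2)) ≤ A)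
    (hz : Real.sqrt (∑ k, η.2.1 k ^ 2) ≤ A) (hf : ∀ i, Real.sqrt (∑ k, η.2.2 i k ^ 2) ≤ A) :
    ∃ d₁ d₂ d₃ d₄ : ℝ → ℝ, (∀ t, HasDerivAt (fun t : ℝ => chartDeficit L z χ (blowUpPoint t (gnomonicPoint a ε η))) (d₁ t) t) ∧
      (∀ t, HasDerivAt d₁ (d₂ t) t) ∧ (∀ t, HasDerivAt d₂ (d₃ t) t) ∧ (∀ t, HasDerivAt d₃ (d₄ t) t) ∧
      ∀ t, |d₁ t| ≤ 720 * (L : ℝ) ^ 4 * A ∧ |d₂ t| ≤ 20400 * (L : ℝ) ^ 4 * A ^ 2 ∧ |d₃ t| ≤ 2484000 * (L : ℝ) ^ 4 * A ^ 3 ∧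
        |d₄ t| ≤ 381240000 * (L : ℝ) ^ 4 * A ^ 4 := by
  -- the letters: leaders `≤ 3A`, followers `≤ A`
  have hC : ∀ μ : Fin 4, ∃ f₁ f₂ f₃ f₄ : ℝ → ℍ, (∀ t, HasDerivAt (fun t => su2Quat ((blowUpPoint (L := L) t (gnomonicPoint a ε η)).1 μ)) (f₁ t) t) ∧ (∀ t, HasDerivAt f₁ (f₂ t) t) ∧ (∀ t, HasDerivAt f₂ (f₃ t) t) ∧
      (∀ t, HasDerivAt f₃ (f₄ t) t) ∧ ∀ t, ‖su2Quat ((blowUpPoint (L := L) t (gnomonicPoint a ε η)).1 μ)‖ ≤ 1 ∧ ‖f₁ t‖ ≤ (3 * A) ∧ ‖f₂ t‖ ≤ (3 * A) ^ 2 ∧ ‖f₃ t‖ ≤ 3 * (3 * A) ^ 3 ∧ ‖f₄ t‖ ≤ 9 * (3 * A) ^ 4 :=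
    fun μ => jet4_mono (by positivity) (by linarith) (jet4_leader_blowUpPoint ha ε η μ)
  have hU : ∀ i : Fol L, ∃ f₁ f₂ f₃ f₄ : ℝ → ℍ, (∀ t, HasDerivAt (fun t => su2Quat ((blowUpPoint (L := L) t (gnomonicPoint a ε η)).2 i)) (f₁ t) t) ∧ (∀ t, HasDerivAt f₁ (f₂ t) t) ∧ (∀ t, HasDerivAt f₂ (f₃ t) t) ∧
      (∀ t, HasDerivAt f₃ (f₄ t) t) ∧ ∀ t, ‖su2Quat ((blowUpPoint (L := L) t (gnomonicPoint a ε η)).2 i)‖ ≤ 1 ∧ ‖f₁ t‖ ≤ A ∧ ‖f₂ t‖ ≤ A ^ 2 ∧ ‖f₃ t‖ ≤ 3 * A ^ 3 ∧ ‖f₄ t‖ ≤ 9 * A ^ 4 :=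
    fun i => jet4_mono (Real.sqrt_nonneg _) (hf i) (jet4_follower a ε η i)
  -- the words and the deficit
  obtain ⟨hl, hs⟩ := jet4_fixHistory (C := fun t => (blowUpPoint (L := L) t (gnomonicPoint a ε η)).1)
    (U := fun t => (blowUpPoint (L := L) t (gnomonicPoint a ε η)).2) χ (by positivity : (0 : ℝ) ≤ 3 * A) hA hC hU
  have e5 : 3 * A + A + A = 5 * A := by ring
  rw [e5] at hl hs
  have h := realJet4_qDeficit_le (L := L) z (M := 5 * A) (by positivity)
    (Q := fun t => ((fun (i : Fin (2 * L - 1 + 1)) (e : Edge 3 L) =>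
        su2Quat ((fixHistory (ringConfig χ (blowUpPoint (L := L) t (gnomonicPoint a ε η)))).1 i e)),
      fun x : Site 3 L => su2Quat ((fixHistory (ringConfig χ (blowUpPoint (L := L) t (gnomonicPoint a ε η)))).2 x)))
    (fun i e => hl i e) (fun x => hs x)
  have e : (fun t : ℝ => chartDeficit L z χ (blowUpPoint t (gnomonicPoint a ε η))) = fun t => qDeficit z
      ((fun (i : Fin (2 * L - 1 + 1)) (e : Edge 3 L) => su2Quat ((fixHistory (ringConfig χ (blowUpPoint (L := L) t (gnomonicPoint a ε η)))).1 i e)),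
        fun x : Site 3 L => su2Quat ((fixHistory (ringConfig χ (blowUpPoint (L := L) t (gnomonicPoint a ε η)))).2 x)) :=
    funext fun t => swapRingDeficit_eq_qDeficit z _
  rw [e]
  refine realJet4_mono ?_ ?_ ?_ ?_ h
  · nlinarith [pow_nonneg (Nat.cast_nonneg L : (0 : ℝ) ≤ L) 4]
  · nlinarith [pow_nonneg (Nat.cast_nonneg L : (0 : ℝ) ≤ L) 4, sq_nonneg A]
  · nlinarith [pow_nonneg (Nat.cast_nonneg L : (0 : ℝ) ≤ L) 4, pow_nonneg hA 3]
  · nlinarith [pow_nonneg (Nat.cast_nonneg L : (0 : ℝ) ≤ L) 4, pow_nonneg hA 4]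

end Summit.QuantumFields.YangMills.Theorems.SwapVirialDeficit.Gnomonic

end
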